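import Literature.Computability.AlgebraicComplexity.SubgroupTPPQuotient
import Literature.GroupTheory.Nilpotent.FrattiniCommutator
import HarnessLib

/-!
# Murthy 2026, Cor. 2.12 (4): no member of a non-trivial subgroup TPP triple of a finite `p`-group
(indeed of a finite nilpotent group) contains the Frattini subgroup

Topic `Literature/Computability/AlgebraicComplexity`; a two-line corollary joining
`SubgroupTPPQuotient.lean` (`Murthy2026_cor212_1`: a member containing `G'` makes the triple trivial)
and `Literature/GroupTheory/Nilpotent/FrattiniCommutator.lean` (`commutator_le_frattini`:
`G' ≤ Φ(G)` in a nilpotent group, Clement–Majewicz–Zyman 2017, Cor. 7.9).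

S. R. Murthy, arXiv:2602.15796 (2026), Cor. 2.12, verbatim: "Let `G` be a nonabelian group and
`(S, T, U)` a non-trivial subgroup TPP triple of `G`, that is, one such that `|S||T||U| > |G|`. Then
[…] (4) If `G` is a `p`-group then no member `S, T, U` contains the Frattini subgroup `Φ(G)`.
*Proof.* […] (4) If `G` is a (nonabelian) `p`-group then the Frattini subgroup `Φ(G)` contains a
non-trivial commutator subgroup `G'`, and the conclusion follows from (1)."

## What is here (proved; 0 definitions, 0 named facts)
* `Murthy2026_cor212_4_nilpotent` — contrapositive form for finite nilpotent `G`: `Φ(G) ≤ S` forces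
  `|S||T||U| ≤ |G|`; `Murthy2026_cor212_4` — the printed `p`-group case.

## References
* [Murthy2026] Cor. 2.12 (4), pp. 8–9.  * [ClementMajewiczZyman2017] Cor. 7.9.
-/

namespace Literature.Computability.AlgebraicComplexity

open DihedralSubgroups Literature.GroupTheory.Nilpotent

variable {G : Type*} [Group G]

/-- **Murthy 2026, Cor. 2.12 (4), for finite nilpotent groups** (contrapositive): a member of a
subgroup TPP triple containing the Frattini subgroup makes the triple trivial, `|S||T||U| ≤ |G|`
(`Φ(G) ⊇ G'` and Cor. 2.12 (1)). [cite: Murthy2026, Corollary 2.12 (4)]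
[cite: ClementMajewiczZyman2017, Cor. 7.9] -/
theorem Murthy2026_cor212_4_nilpotent [Finite G] [Group.IsNilpotent G] {S T U : Subgroup G}
    (h : SubgroupTPP S T U) (hS : frattini G ≤ S) :
    Nat.card S * Nat.card T * Nat.card U ≤ Nat.card G :=
  Murthy2026_cor212_1 h (commutator_le_frattini.trans hS)

/-- **Murthy 2026, Cor. 2.12 (4)** as printed (finite `p`-groups, contrapositive form).
[cite: Murthy2026, Corollary 2.12 (4)] -/
theorem Murthy2026_cor212_4 [Finite G] {p : ℕ} [Fact p.Prime] (hG : IsPGroup p G)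
    {S T U : Subgroup G} (h : SubgroupTPP S T U) (hS : frattini G ≤ S) :
    Nat.card S * Nat.card T * Nat.card U ≤ Nat.card G :=
  Murthy2026_cor212_1 h ((IsPGroup.commutator_le_frattini hG).trans hS)

end Literature.Computability.AlgebraicComplexity
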